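import Mathlib
import HarnessLib
import Summits.HubbardSuperconductivity.HubbardSuperconductivity.Theorems.KLProgrammeKLRegimeEnginePairTransferMemberTwoShellRoom
import Summits.HubbardSuperconductivity.HubbardSuperconductivity.Theorems.KLProgrammeKLRegimeEnginePairTransferMassesFlat
import Summits.HubbardSuperconductivity.HubbardSuperconductivity.Theorems.KLProgrammeKLRegimeEnginePairTransferMemberRates

/-!
# Route `KLProgramme` — ENGINE item stmt-HubbardSuperconductivity-20437 `KLRegimeEngineV17F2`, class-#5 STEP (X).3: «PH-PROFILE» — the member particle–hole masses
# `Wd_j(t,x,y)`, `Wx_j(t,x,y)` of `klmd_defect_le_masses_family` as a PROFILE IN THE TRANSFER (flat core + two-shell tail, the `√Λ` caustic term explicit)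
# (cell gate-hubbard-kl, seat hubbard-kl-k3c2-p2 g17; the pricing asked by k3c1-p1 g15's located reading «(X).3-RESOLVED-STEP» and endorsed by (R200))

WHAT.  For the member-`j` running symbol `φ_j(t) = Φ_{n+1,j} + (w_{Λₙ₊₁} − w_{Λ(t)})` against the slice line `ẇ_{Λ(t)}`, in the door's normalisation
`(Λₙ−Λₙ₊₁)((βL²)³)⁻¹ · (mass)`, SIGN-BLIND (norm inside, exactly the `Wd_j / Wx_j` slots of the masses form):
* CORE (every transfer): `Wd_member_row_flat_le` `≤ 2048·15367`, `Wx_member_row_flat_le` `≤ 1024·15367` — `direct/crossed_row_flat_le` (…MassesFlat) with the soft mass of the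
  running symbol `≤ 15367` (`klmf_runningSymbol_mem` + `klSoftMass_le_of_frameOK`; needs `klBetaMin ≤ β ≤ L`, `FrameOK`);
* TAIL (`G·|q|_𝕋 ≥ Λₙ₊₁/8`): `Wd/Wx_member_row_le_slots` (…MemberTwoShellRoom): `≤ c·(27/(8π²))·A·(16/π)·(10 + 50Gβ/L)·(16384·G²·min(|q|/Λₙ₊₁, Λₙ₊₁/|q|) + (√2/4)·2⁻ⁿ)`,
  `c = 512/3 | 256/3`; the additive `(√2/4)·2⁻ⁿ = √(4Λₙ)` is the caustic / antipodal `√Λ` term of the two-shell area, the `min` is the `Λ/|q|` profile;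
* ENVELOPE: `Wd_member_row_le_profile` / `Wx_member_row_le_profile` — one `if`-majorant in `r = |q|_𝕋` (core below the threshold `G·r < Λₙ₊₁/8`, tail above), the
  shape a layer-cake consumer integrates against the windowed masses of the relative transfer weight («(ᾱ)-WINDOW», p1's `klam_window_abs_klTransferWeight_le_linear`).
Sizes [paper, for the pen]: against a window mass `≤ (c₁s + c₂/L)·M_D` the envelope integrates by dyadic shells to
`≲ M4²·M_D·(F·(c₁Λₙ₊₁/(8G) + c₂/L) + C_A·16384G²·(2c₁Λₙ₊₁·log(8G/Λₙ₊₁) + 16G·c₂/L) + C_A·(√2/4)·2⁻ⁿ·Σᾱ)`, `F = 2048·15367`, `C_A = (512/3)(27/8π²)·A·(16/π)(10+50Gβ/L)` —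
the ROOM's slot types `n·4⁻ⁿ`, `2⁻ⁿ`, `1/L` times the relative mass, constants against `r`, not against `2ⁿ`.  Arithmetic / bookkeeping only; nothing about the model's
sizes is asserted; nothing asserts (X).3, (c), K3 or superconductivity.  0 kit · 0 lit.
-/

noncomputable section

namespace Summit.HubbardSuperconductivity.HubbardSuperconductivity.Theorems.KLRegimeSplit

set_option linter.dupNamespace false -- summit = problem name (single-conjunct summit), D-0017

open Real Finset Set Literature.MathematicalPhysics.QuantumLattice Literature.Probability.LatticeModels
open Literature.MathematicalPhysics.QuantumLattice.FermiRG
open Summit.HubbardSuperconductivity.HubbardSuperconductivity.Theorems.KLProgrammeLegKernels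
open Summit.HubbardSuperconductivity.HubbardSuperconductivity.Theorems.TwoPointAssembly
open Summit.HubbardSuperconductivity.HubbardSuperconductivity.Theorems.DispersionFlow
open Summit.HubbardSuperconductivity.HubbardSuperconductivity.Theorems.KLRegimeWick
open Summit.HubbardSuperconductivity.HubbardSuperconductivity.Theorems.EngineV8
open Summit.HubbardSuperconductivity.HubbardSuperconductivity.Theorems.PerturbedFermiCurve

/-! ## §1 The soft mass of the running member symbol -/

/-- The running member symbol `φ_j(t) = Φ_{n+1,j} + (w_{Λₙ₊₁} − w_{Λ(t)})` (`n+1 ≤ j`, `t ∈ [0,1]`) has soft mass `≤ 15367` at scale `n` (`klBetaMin ≤ β ≤ L`, `FrameOK`). -/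
theorem klSoftMass_runningMember_le {L M : ℕ} [NeZero L] (β μ : ℝ) (K : TrigPolyC4v) {R : RenConsts} {U : ℝ} {N : ℕ} (hK : FrameOK R U N μ K)
    (hβm : klBetaMin ≤ β) (hβL : β ≤ L) (n : ℕ) {j : ℕ} (hj : n + 1 ≤ j) {t : ℝ} (ht : t ∈ Icc (0 : ℝ) 1) :
    klSoftMass L M β μ K n (fun p => softSymbolCompl L M β μ K (n + 1) j p + (hubbardCutoffWeightCT L M β μ K (klScale klE0 (n + 1)) p -
      hubbardCutoffWeightCT L M β μ K (klScale klE0 n + t * (klScale klE0 (n + 1) - klScale klE0 n)) p)) ≤ 15367 :=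
  klSoftMass_le_of_frameOK (L := L) (M := M) (β := β) (μ := μ) (K := K) hK hβm hβL n
    (fun k => klmf_runningSymbol_mem L M β μ K n (isSoftSymbol_compl β μ K hj).1 ht k)

/-! ## §2 CORE: the flat rows at every transfer -/

/-- **Member direct PH mass, flat core** (every transfer): `(Λₙ−Λₙ₊₁)((βL²)³)⁻¹·Wd_j(t,x,y) ≤ 2048·15367`. -/
theorem Wd_member_row_flat_le {L M : ℕ} [NeZero L] [NeZero M] (β μ : ℝ) (K : TrigPolyC4v) {R : RenConsts} {U : ℝ} {N : ℕ} (hK : FrameOK R U N μ K)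
    (hβm : klBetaMin ≤ β) (hβL : β ≤ L) (n : ℕ) {j : ℕ} (hj : n + 1 ≤ j) {t : ℝ} (ht : t ∈ Icc (0 : ℝ) 1) (x y : TorusSite 2 L) :
    (klScale klE0 n - klScale klE0 (n + 1)) * ((β * (L : ℝ) ^ 2) ^ 3)⁻¹ *
      ∑ p : FreqMomentum L M, ∑ _σ : Fin 2, ∑ p' : FreqMomentum L M,
        (if matsubaraInt M p'.1 + matsubaraInt M (omega0 M) = matsubaraInt M p.1 + matsubaraInt M (omega0 M) ∧ p'.2 = p.2 + x - y then
          ‖((((softSymbolCompl L M β μ K (n + 1) j p + (hubbardCutoffWeightCT L M β μ K (klScale klE0 (n + 1)) p -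
                hubbardCutoffWeightCT L M β μ K (klScale klE0 n + t * (klScale klE0 (n + 1) - klScale klE0 n)) p) : ℝ)) : ℂ) *
                (((β * (L : ℝ) ^ 2 : ℝ) : ℂ) * propCT L M β μ K p)) *
              ((((deriv (fun Λ' : ℝ => hubbardCutoffWeightCT L M β μ K Λ' p') (klScale klE0 n + t * (klScale klE0 (n + 1) - klScale klE0 n)) : ℝ)) : ℂ) *
                (((β * (L : ℝ) ^ 2 : ℝ) : ℂ) * propCT L M β μ K p')) +
            ((((deriv (fun Λ' : ℝ => hubbardCutoffWeightCT L M β μ K Λ' p) (klScale klE0 n + t * (klScale klE0 (n + 1) - klScale klE0 n)) : ℝ)) : ℂ) *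
                (((β * (L : ℝ) ^ 2 : ℝ) : ℂ) * propCT L M β μ K p)) *
              ((((softSymbolCompl L M β μ K (n + 1) j p' + (hubbardCutoffWeightCT L M β μ K (klScale klE0 (n + 1)) p' -
                hubbardCutoffWeightCT L M β μ K (klScale klE0 n + t * (klScale klE0 (n + 1) - klScale klE0 n)) p') : ℝ)) : ℂ) *
                (((β * (L : ℝ) ^ 2 : ℝ) : ℂ) * propCT L M β μ K p'))‖
        else 0) ≤ 2048 * 15367 := by
  have hβ : 0 < β := pos_of_klBetaMin_le hβm
  have h := direct_row_flat_le β μ K hβ n ht (fun p => softSymbolCompl L M β μ K (n + 1) j p +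
    (hubbardCutoffWeightCT L M β μ K (klScale klE0 (n + 1)) p - hubbardCutoffWeightCT L M β μ K (klScale klE0 n + t * (klScale klE0 (n + 1) - klScale klE0 n)) p)) x y
  have hms := klSoftMass_runningMember_le (L := L) (M := M) β μ K hK hβm hβL n hj ht
  exact h.trans (by linarith)

/-- **Member crossed PH mass, flat core** (every transfer): `(Λₙ−Λₙ₊₁)((βL²)³)⁻¹·Wx_j(t,x,y) ≤ 1024·15367`. -/
theorem Wx_member_row_flat_le {L M : ℕ} [NeZero L] [NeZero M] (β μ : ℝ) (K : TrigPolyC4v) {R : RenConsts} {U : ℝ} {N : ℕ} (hK : FrameOK R U N μ K)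
    (hβm : klBetaMin ≤ β) (hβL : β ≤ L) (n : ℕ) {j : ℕ} (hj : n + 1 ≤ j) {t : ℝ} (ht : t ∈ Icc (0 : ℝ) 1) (Qm x y : TorusSite 2 L) :
    (klScale klE0 n - klScale klE0 (n + 1)) * ((β * (L : ℝ) ^ 2) ^ 3)⁻¹ *
      ∑ p : FreqMomentum L M, ∑ p' : FreqMomentum L M,
        (if matsubaraInt M p'.1 + matsubaraInt M (omega0 M) + matsubaraInt M (omega0 M) + 1 = matsubaraInt M p.1 ∧ p'.2 = p.2 + Qm - x - y then
          ‖((((softSymbolCompl L M β μ K (n + 1) j p + (hubbardCutoffWeightCT L M β μ K (klScale klE0 (n + 1)) p -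
                hubbardCutoffWeightCT L M β μ K (klScale klE0 n + t * (klScale klE0 (n + 1) - klScale klE0 n)) p) : ℝ)) : ℂ) *
                (((β * (L : ℝ) ^ 2 : ℝ) : ℂ) * propCT L M β μ K p)) *
              ((((deriv (fun Λ' : ℝ => hubbardCutoffWeightCT L M β μ K Λ' p') (klScale klE0 n + t * (klScale klE0 (n + 1) - klScale klE0 n)) : ℝ)) : ℂ) *
                (((β * (L : ℝ) ^ 2 : ℝ) : ℂ) * propCT L M β μ K p')) +
            ((((deriv (fun Λ' : ℝ => hubbardCutoffWeightCT L M β μ K Λ' p) (klScale klE0 n + t * (klScale klE0 (n + 1) - klScale klE0 n)) : ℝ)) : ℂ) *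
                (((β * (L : ℝ) ^ 2 : ℝ) : ℂ) * propCT L M β μ K p)) *
              ((((softSymbolCompl L M β μ K (n + 1) j p' + (hubbardCutoffWeightCT L M β μ K (klScale klE0 (n + 1)) p' -
                hubbardCutoffWeightCT L M β μ K (klScale klE0 n + t * (klScale klE0 (n + 1) - klScale klE0 n)) p') : ℝ)) : ℂ) *
                (((β * (L : ℝ) ^ 2 : ℝ) : ℂ) * propCT L M β μ K p'))‖
        else 0) ≤ 1024 * 15367 := by
  have hβ : 0 < β := pos_of_klBetaMin_le hβm
  have h := crossed_row_flat_le β μ K hβ n ht (fun p => softSymbolCompl L M β μ K (n + 1) j p +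
    (hubbardCutoffWeightCT L M β μ K (klScale klE0 (n + 1)) p - hubbardCutoffWeightCT L M β μ K (klScale klE0 n + t * (klScale klE0 (n + 1) - klScale klE0 n)) p)) Qm x y
  have hms := klSoftMass_runningMember_le (L := L) (M := M) β μ K hK hβm hβL n hj ht
  exact h.trans (by linarith)

/-! ## §3 ENVELOPE: one majorant in the transfer radius (core below the threshold `G·r < Λₙ₊₁/8`, two-shell tail above) -/

/-- **«PH-PROFILE», direct**: with `G = 4 + (8/3)·Gfr₁·U²`, `r = |x−y|_𝕋`, under the hypotheses of the core and of `Wd_member_row_le_slots`,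
`(Λₙ−Λₙ₊₁)((βL²)³)⁻¹·Wd_j(t,x,y) ≤ if G·r < Λₙ₊₁/8 then 2048·15367 else (512/3)(27/8π²)·A·(16/π)·(10 + 50Gβ/L)·(16384·G²·min(r/Λₙ₊₁, Λₙ₊₁/r) + (√2/4)·2⁻ⁿ)`. -/
theorem Wd_member_row_le_profile {L M : ℕ} [NeZero L] [NeZero M] (β μ : ℝ) (K : TrigPolyC4v) {A : ℝ} {u : RenConsts → ℝ} (h : TwoShellFrameAreaAt A u)
    (hA : 0 ≤ A) {R : RenConsts} (hR : R.WF2) {U : ℝ} (hU : 0 < U) (hUu : U ≤ u R) (hμ : μ ∈ klWindowC) {N : ℕ} (hK : FrameOK R U N μ K)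
    (hβm : klBetaMin ≤ β) (hβL : β ≤ L) (n : ℕ) {j : ℕ} (hj : n + 1 ≤ j) (hj'β : π / (4 * β) ≤ klScale klE0 (n + 1)) {t : ℝ} (ht : t ∈ Icc (0 : ℝ) 1)
    (hGδ : (4 + 8 / 3 * R.Gfr 1 * U ^ 2) * (2 * π / L) ≤ klScale klE0 (n + 1))
    (hE0 : 2 * klScale klE0 n + (4 + 8 / 3 * R.Gfr 1 * U ^ 2) * (2 * π / L) ≤ klE0) (x y : TorusSite 2 L) :
    (klScale klE0 n - klScale klE0 (n + 1)) * ((β * (L : ℝ) ^ 2) ^ 3)⁻¹ *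
      ∑ p : FreqMomentum L M, ∑ _σ : Fin 2, ∑ p' : FreqMomentum L M,
        (if matsubaraInt M p'.1 + matsubaraInt M (omega0 M) = matsubaraInt M p.1 + matsubaraInt M (omega0 M) ∧ p'.2 = p.2 + x - y then
          ‖((((softSymbolCompl L M β μ K (n + 1) j p + (hubbardCutoffWeightCT L M β μ K (klScale klE0 (n + 1)) p -
                hubbardCutoffWeightCT L M β μ K (klScale klE0 n + t * (klScale klE0 (n + 1) - klScale klE0 n)) p) : ℝ)) : ℂ) *
                (((β * (L : ℝ) ^ 2 : ℝ) : ℂ) * propCT L M β μ K p)) *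
              ((((deriv (fun Λ' : ℝ => hubbardCutoffWeightCT L M β μ K Λ' p') (klScale klE0 n + t * (klScale klE0 (n + 1) - klScale klE0 n)) : ℝ)) : ℂ) *
                (((β * (L : ℝ) ^ 2 : ℝ) : ℂ) * propCT L M β μ K p')) +
            ((((deriv (fun Λ' : ℝ => hubbardCutoffWeightCT L M β μ K Λ' p) (klScale klE0 n + t * (klScale klE0 (n + 1) - klScale klE0 n)) : ℝ)) : ℂ) *
                (((β * (L : ℝ) ^ 2 : ℝ) : ℂ) * propCT L M β μ K p)) *
              ((((softSymbolCompl L M β μ K (n + 1) j p' + (hubbardCutoffWeightCT L M β μ K (klScale klE0 (n + 1)) p' -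
                hubbardCutoffWeightCT L M β μ K (klScale klE0 n + t * (klScale klE0 (n + 1) - klScale klE0 n)) p') : ℝ)) : ℂ) *
                (((β * (L : ℝ) ^ 2 : ℝ) : ℂ) * propCT L M β μ K p'))‖
        else 0) ≤
      if (4 + 8 / 3 * R.Gfr 1 * U ^ 2) * klTorusNorm L (x - y) < klScale klE0 (n + 1) / 8 then 2048 * 15367 else
        512 / 3 * (27 / (8 * π ^ 2)) * A * (16 / π) * (10 + 50 * (4 + 8 / 3 * R.Gfr 1 * U ^ 2) * β / L) *
          (16384 * (4 + 8 / 3 * R.Gfr 1 * U ^ 2) ^ 2 * min (klTorusNorm L (x - y) / klScale klE0 (n + 1)) (klScale klE0 (n + 1) / klTorusNorm L (x - y)) +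
            Real.sqrt 2 / 4 * ((2 : ℝ) ^ n)⁻¹) := by
  split_ifs with hlt
  · exact Wd_member_row_flat_le β μ K hK hβm hβL n hj ht x y
  · exact Wd_member_row_le_slots β μ K h hA hR hU hUu hμ hK (pos_of_klBetaMin_le hβm) n hj hj'β ht hGδ hE0 (not_lt.1 hlt)

/-- **«PH-PROFILE», crossed** (transfer `x + y − Qm`): the same envelope with `1024·15367` / `256/3`. -/
theorem Wx_member_row_le_profile {L M : ℕ} [NeZero L] [NeZero M] (β μ : ℝ) (K : TrigPolyC4v) {A : ℝ} {u : RenConsts → ℝ} (h : TwoShellFrameAreaAt A u)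
    (hA : 0 ≤ A) {R : RenConsts} (hR : R.WF2) {U : ℝ} (hU : 0 < U) (hUu : U ≤ u R) (hμ : μ ∈ klWindowC) {N : ℕ} (hK : FrameOK R U N μ K)
    (hβm : klBetaMin ≤ β) (hβL : β ≤ L) (n : ℕ) {j : ℕ} (hj : n + 1 ≤ j) (hj'β : π / (4 * β) ≤ klScale klE0 (n + 1)) {t : ℝ} (ht : t ∈ Icc (0 : ℝ) 1)
    (hGδ : (4 + 8 / 3 * R.Gfr 1 * U ^ 2) * (2 * π / L) ≤ klScale klE0 (n + 1))
    (hE0 : 2 * klScale klE0 n + (4 + 8 / 3 * R.Gfr 1 * U ^ 2) * (2 * π / L) ≤ klE0) (Qm x y : TorusSite 2 L) :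
    (klScale klE0 n - klScale klE0 (n + 1)) * ((β * (L : ℝ) ^ 2) ^ 3)⁻¹ *
      ∑ p : FreqMomentum L M, ∑ p' : FreqMomentum L M,
        (if matsubaraInt M p'.1 + matsubaraInt M (omega0 M) + matsubaraInt M (omega0 M) + 1 = matsubaraInt M p.1 ∧ p'.2 = p.2 + Qm - x - y then
          ‖((((softSymbolCompl L M β μ K (n + 1) j p + (hubbardCutoffWeightCT L M β μ K (klScale klE0 (n + 1)) p -
                hubbardCutoffWeightCT L M β μ K (klScale klE0 n + t * (klScale klE0 (n + 1) - klScale klE0 n)) p) : ℝ)) : ℂ) *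
                (((β * (L : ℝ) ^ 2 : ℝ) : ℂ) * propCT L M β μ K p)) *
              ((((deriv (fun Λ' : ℝ => hubbardCutoffWeightCT L M β μ K Λ' p') (klScale klE0 n + t * (klScale klE0 (n + 1) - klScale klE0 n)) : ℝ)) : ℂ) *
                (((β * (L : ℝ) ^ 2 : ℝ) : ℂ) * propCT L M β μ K p')) +
            ((((deriv (fun Λ' : ℝ => hubbardCutoffWeightCT L M β μ K Λ' p) (klScale klE0 n + t * (klScale klE0 (n + 1) - klScale klE0 n)) : ℝ)) : ℂ) *
                (((β * (L : ℝ) ^ 2 : ℝ) : ℂ) * propCT L M β μ K p)) *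
              ((((softSymbolCompl L M β μ K (n + 1) j p' + (hubbardCutoffWeightCT L M β μ K (klScale klE0 (n + 1)) p' -
                hubbardCutoffWeightCT L M β μ K (klScale klE0 n + t * (klScale klE0 (n + 1) - klScale klE0 n)) p') : ℝ)) : ℂ) *
                (((β * (L : ℝ) ^ 2 : ℝ) : ℂ) * propCT L M β μ K p'))‖
        else 0) ≤
      if (4 + 8 / 3 * R.Gfr 1 * U ^ 2) * klTorusNorm L (x + y - Qm) < klScale klE0 (n + 1) / 8 then 1024 * 15367 else
        256 / 3 * (27 / (8 * π ^ 2)) * A * (16 / π) * (10 + 50 * (4 + 8 / 3 * R.Gfr 1 * U ^ 2) * β / L) *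
          (16384 * (4 + 8 / 3 * R.Gfr 1 * U ^ 2) ^ 2 * min (klTorusNorm L (x + y - Qm) / klScale klE0 (n + 1)) (klScale klE0 (n + 1) / klTorusNorm L (x + y - Qm)) +
            Real.sqrt 2 / 4 * ((2 : ℝ) ^ n)⁻¹) := by
  split_ifs with hlt
  · exact Wx_member_row_flat_le β μ K hK hβm hβL n hj ht Qm x y
  · exact Wx_member_row_le_slots β μ K h hA hR hU hUu hμ hK (pos_of_klBetaMin_le hβm) n hj hj'β ht hGδ hE0 (not_lt.1 hlt)

end Summit.HubbardSuperconductivity.HubbardSuperconductivity.Theorems.KLRegimeSplit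

end
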